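import Literature.Algebra.Homology.DiscreteRepCoresRes
import Literature.Algebra.Homology.DiscreteRepRestrictionExact
import Literature.Algebra.Homology.ExtDualityPairing
import HarnessLib

/-!
# Compatibility of the Yoneda duality pairing with Shapiro's isomorphisms and corestriction
# (Harari Prop. 16.18, `Ext` form): the Shapiro column of Milne's ladder (1.9.1)

Topic `Algebra/Homology`; namespaces `Literature.Algebra.Homology.ExtAdjunction` (one generic lemma)
and `Literature.Algebra.Homology.DiscreteRep`.  Theorems only; no definition, no named fact, no
instance, no `sorry`.  Sequel of `DiscreteRepCoresRes` (`extCores`, `cores ∘ res = [Γ : U]`),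
`DiscreteRepOpenSubgroupCanonical` (`shapiroCanonical`), the engine `ExtAdjunctionCanonical`
(`extAdjunctionAddEquiv : Ext(L A, B) ≃+ Ext(A, R B)`, `x ↦ [η_A] ∘ R x`) and `ExtDualityPairing`
(`⟨x, y⟩ = inv (y ∘ x)`, `adjointMap = α^r`).

Setting: `Γ` a topological group, `U ≤ Γ` open of finite index, `k` a commutative ring,
`C_Γ = DiscreteRepCat k Γ` (with enough injectives); `Coind = coindD k U hU : C_U ⥤ C_Γ`,
`Res = resD k U`, the adjunctions `Res ⊣ Coind` (`resCoindAdj`) and `Coind ⊣ Res` (`coindResAdj`).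
The two Shapiro isomorphisms, canonically:
* `Sh₂ := shapiroCanonical U hU (triv k) N s : Extˢ_U(k, N) ≃+ Extˢ_Γ(k, Coind N)`, `y ↦ [η_k] ∘ Coind y`
  (Harari Remark 16.13);
* `Sh₁ := ExtAdjunction.extAdjunctionAddEquiv (coindResAdj U hU) N A r :
  Extʳ_Γ(Coind N, A) ≃+ Extʳ_U(N, Res A)`, `x ↦ [η'_N] ∘ Res x` (Harari Prop. 1.39, first variable).

* `ExtAdjunction.mk₀_map_unitHom_comp` (generic, any adjunction `L ⊣ R` with `R` exact):
  `[L η_A] ∘ L(R(x)) ∘ [ε_B] = x` on `Ext(L A, B)` (triangle identity + naturality of `ε`);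
* **`extCores_comp_shapiro`** (Harari Prop. 16.18): `cores (y ∘ Sh₁ x) = Sh₂ y ∘ x` in `Extˢ⁺ʳ_Γ(k, A)`;
* `pairing_shapiro`: with `inv_U := inv_Γ ∘ cores` (class-formation normalisation `inv_U = inv_Γ ∘ Cor`),
  `⟨Sh₁ x, y⟩_U = ⟨x, Sh₂ y⟩_Γ`; `adjointMap_shapiro` (adjoint form);
* **`adjointInjective_coind_iff`, `adjointSurjective_coind_iff`, `adjointBijective_coind_iff`**:
  `α^r(Γ, Coind N)` is injective / surjective / bijective iff `α^r(U, N)` is (for `inv_U = inv_Γ ∘ cores`)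
  — the second column of Milne's ladder (1.9.1): `M_* = Coind_U^Γ Res M`,
  `Extʳ_Γ(M_*, C) = Extʳ_U(M, C)`, `Hˢ(Γ, M_*) = Hˢ(U, M)` compatibly with the pairings.

Written for Route A of the Poitou–Tate programme of crux `stmt-BirchSwinnertonDyer-19295` (cell
`bsd-schneider-ideate`, seat door-c4 gen 15).  HONEST FRAMING: homological algebra only.

## References
* D. Harari, *Galois Cohomology and Class Field Theory*, Universitext (2020), Proposition 1.39 (p. 48),
  Remark 16.13 (p. 269), Proposition 16.18 (p. 272), §16.3 (pp. 274–275). [Harari2020]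
* J. S. Milne, *Arithmetic Duality Theorems* (2nd ed. 2006), I §1, proof of Theorem 1.8 (diagram
  (1.9.1)) and I (0.3). [MilneADT2006]
-/

noncomputable section

universe w' w v v' u u'

namespace Literature.Algebra.Homology

/-! ## §0 A triangle identity on `Ext` for an adjunction -/

namespace ExtAdjunction

open CategoryTheory CategoryTheory.Limits CategoryTheory.Abelian

variable {C : Type u} [Category.{v} C] [Abelian C] [HasExt.{w} C]
  {D : Type u'} [Category.{v'} D] [Abelian D] [HasExt.{w} D]
  {L : C ⥤ D} {R : D ⥤ C} (adj : L ⊣ R) [R.Additive] [PreservesFiniteLimits R]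
  [PreservesFiniteColimits R] [L.Additive] [PreservesFiniteLimits L] [PreservesFiniteColimits L]
  [EnoughInjectives D]

/-- **`[L η_A] ∘ L(R(x)) ∘ [ε_B] = x`** for `x ∈ Ext(L A, B)`: the triangle identity
`L η_A ≫ ε_{L A} = 𝟙` combined with the naturality of the counit `ε : R ⋙ L ⟶ 𝟭` on `Ext`
(stated with `(x.mapExactFunctor R).mapExactFunctor L`). [cite: Harari2020, Proposition 1.39] -/
theorem mk₀_map_unitHom_comp (A : C) {B : D} {r : ℕ} (x : Ext (L.obj A) B r) :
    (Ext.mk₀ (L.map (unitHom adj A))).comp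
        (((x.mapExactFunctor R).mapExactFunctor L).comp (Ext.mk₀ (adj.counit.app B)) (add_zero r))
        (zero_add r) = x := by
  haveI := comp_preservesFiniteLimits R L
  haveI := comp_preservesFiniteColimits R L
  rw [← ExtFunctoriality.mapExactFunctor_comp_functor R L x]
  have hnat := ExtFunctoriality.mapExactFunctor_natTrans (F := R ⋙ L) (G := 𝟭 D) adj.counit x
  rw [ExtFunctoriality.mapExactFunctor_id] at hnat
  have htri : L.map (unitHom adj A) ≫ adj.counit.app (L.obj A) = 𝟙 _ := by
    rw [unitHom, Adjunction.homEquiv_id]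
    exact adj.left_triangle_components A
  erw [← hnat]
  erw [Ext.mk₀_comp_mk₀_assoc]
  erw [htri]
  erw [Ext.mk₀_id_comp]

end ExtAdjunction

namespace DiscreteRep

open CategoryTheory CategoryTheory.Limits CategoryTheory.Abelian

variable {k Γ : Type u} [CommRing k] [Group Γ] [TopologicalSpace Γ] [IsTopologicalGroup Γ]
  (U : Subgroup Γ) (hU : IsOpen (U : Set Γ)) [U.FiniteIndex] [EnoughInjectives (DiscreteRepCat k Γ)]

/-! ## §1 `cores (y ∘ Sh₁ x) = Sh₂ y ∘ x` -/

/-- **Harari Prop. 16.18 (`Ext` form): `cores (y ∘ Sh₁ x) = Sh₂ y ∘ x`** for `y ∈ Extˢ_U(k, N)` and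
`x ∈ Extʳ_Γ(Coind N, A)`, where `Sh₁ x = [η'_N] ∘ Res x ∈ Extʳ_U(N, Res A)` and
`Sh₂ y = [η_k] ∘ Coind y ∈ Extˢ_Γ(k, Coind N)`. [cite: Harari2020, Proposition 16.18] -/
theorem extCores_comp_shapiro (N : DiscreteRepCat k U) (A : DiscreteRepCat k Γ) {s r n : ℕ}
    (h : s + r = n) (y : Ext ((resD k U).obj (triv (k := k) (Γ := Γ) k)) N s)
    (x : Ext ((coindD k U hU).obj N) A r) :
    extCores U hU A n (y.comp (ExtAdjunction.extAdjunctionAddEquiv (coindResAdj U hU) N A r x) h) =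
      (shapiroCanonical U hU (triv (k := k) (Γ := Γ) k) N s y).comp x h := by
  rw [extCores_apply, ExtAdjunction.extAdjunctionAddEquiv_apply, shapiroCanonical_apply,
    Ext.mapExactFunctor_comp, Ext.mapExactFunctor_comp, Ext.mapExactFunctor_mk₀,
    Ext.comp_assoc_of_third_deg_zero, Ext.comp_assoc_of_third_deg_zero,
    Ext.comp_assoc_of_third_deg_zero, ExtAdjunction.mk₀_map_unitHom_comp]
  exact (Ext.comp_assoc _ _ _ (zero_add s) h (by omega)).symm

/-! ## §2 The pairings over `U` and over `Γ` correspond -/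

section Pairing

variable {Q : Type w'} [AddCommGroup Q] (C : DiscreteRepCat k Γ)
  (invΓ : Ext (triv (k := k) (Γ := Γ) k) C 2 →+ Q)

/-- **`⟨Sh₁ x, y⟩_U = ⟨x, Sh₂ y⟩_Γ`** for the duality pairings `⟨x, y⟩ = inv (y ∘ x)` with
`inv_U := inv_Γ ∘ cores`. [cite: Harari2020, Proposition 16.18][cite: MilneADT2006, I (1.9.1)] -/
theorem pairing_shapiro (N : DiscreteRepCat k U) {r s : ℕ} (h : s + r = 2)
    (x : Ext ((coindD k U hU).obj N) C r) (y : Ext ((resD k U).obj (triv (k := k) (Γ := Γ) k)) N s) :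
    ExtDuality.pairing (invΓ.comp (extCores U hU C 2)) N h
        (ExtAdjunction.extAdjunctionAddEquiv (coindResAdj U hU) N C r x) y =
      ExtDuality.pairing invΓ ((coindD k U hU).obj N) h x
        (shapiroCanonical U hU (triv (k := k) (Γ := Γ) k) N s y) := by
  rw [ExtDuality.pairing_apply, ExtDuality.pairing_apply, AddMonoidHom.comp_apply,
    extCores_comp_shapiro]

/-- Adjoint form: `α_U(Sh₁ x) = α_Γ(x) ∘ Sh₂`. [cite: Harari2020, Proposition 16.18] -/
theorem adjointMap_shapiro (N : DiscreteRepCat k U) {r s : ℕ} (h : s + r = 2)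
    (x : Ext ((coindD k U hU).obj N) C r) :
    ExtDuality.adjointMap (invΓ.comp (extCores U hU C 2)) N h
        (ExtAdjunction.extAdjunctionAddEquiv (coindResAdj U hU) N C r x) =
      (ExtDuality.adjointMap invΓ ((coindD k U hU).obj N) h x).comp
        (shapiroCanonical U hU (triv (k := k) (Γ := Γ) k) N s).toAddMonoidHom := by
  ext y
  exact pairing_shapiro U hU C invΓ N h x y

/-- Precomposition with an additive equivalence is injective on `Hom(–, Q)`. [folklore] -/
private theorem comp_addEquiv_injective {A B : Type*} [AddCommGroup A] [AddCommGroup B] (e : A ≃+ B) :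
    Function.Injective (fun φ : B →+ Q => φ.comp e.toAddMonoidHom) := by
  intro φ ψ hφψ
  ext b
  have h1 := DFunLike.congr_fun hφψ (e.symm b)
  simpa using h1

/-- Precomposition with an additive equivalence is surjective on `Hom(–, Q)`. [folklore] -/
private theorem comp_addEquiv_surjective {A B : Type*} [AddCommGroup A] [AddCommGroup B] (e : A ≃+ B) :
    Function.Surjective (fun φ : B →+ Q => φ.comp e.toAddMonoidHom) := fun ψ =>
  ⟨ψ.comp e.symm.toAddMonoidHom, by ext a; simp⟩

/-- **Shapiro column of (1.9.1), injectivity**: `α^r(U, N)` (for `inv_U = inv_Γ ∘ cores`) is injective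
iff `α^r(Γ, Coind N)` is. [cite: MilneADT2006, I Theorem 1.8 (proof, (1.9.1))][cite: Harari2020, Proposition 16.18] -/
theorem adjointInjective_coind_iff (N : DiscreteRepCat k U) {r s : ℕ} (h : s + r = 2) :
    ExtDuality.AdjointInjective invΓ ((coindD k U hU).obj N) h ↔
      ExtDuality.AdjointInjective (invΓ.comp (extCores U hU C 2)) N h := by
  have key : ⇑(ExtDuality.adjointMap (invΓ.comp (extCores U hU C 2)) N h) ∘
      ⇑(ExtAdjunction.extAdjunctionAddEquiv (coindResAdj U hU) N C r) =
      (fun φ => φ.comp (shapiroCanonical U hU (triv (k := k) (Γ := Γ) k) N s).toAddMonoidHom) ∘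
        ⇑(ExtDuality.adjointMap invΓ ((coindD k U hU).obj N) h) :=
    funext fun x => adjointMap_shapiro U hU C invΓ N h x
  constructor
  · intro hΓ
    have h2 : Function.Injective (⇑(ExtDuality.adjointMap (invΓ.comp (extCores U hU C 2)) N h) ∘
        ⇑(ExtAdjunction.extAdjunctionAddEquiv (coindResAdj U hU) N C r)) := by
      rw [key]
      exact (comp_addEquiv_injective _).comp hΓ
    exact h2.of_comp_right (AddEquiv.surjective _)
  · intro hU'
    have h2 : Function.Injective ((fun φ => φ.comp (shapiroCanonical U hU (triv (k := k) (Γ := Γ) k) N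
        s).toAddMonoidHom) ∘ ⇑(ExtDuality.adjointMap invΓ ((coindD k U hU).obj N) h)) := by
      rw [← key]
      exact hU'.comp (AddEquiv.injective _)
    exact Function.Injective.of_comp h2

/-- **Shapiro column of (1.9.1), surjectivity**: `α^r(U, N)` is surjective iff `α^r(Γ, Coind N)` is.
[cite: MilneADT2006, I Theorem 1.8 (proof, (1.9.1))][cite: Harari2020, Proposition 16.18] -/
theorem adjointSurjective_coind_iff (N : DiscreteRepCat k U) {r s : ℕ} (h : s + r = 2) :
    ExtDuality.AdjointSurjective invΓ ((coindD k U hU).obj N) h ↔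
      ExtDuality.AdjointSurjective (invΓ.comp (extCores U hU C 2)) N h := by
  have key : ⇑(ExtDuality.adjointMap (invΓ.comp (extCores U hU C 2)) N h) ∘
      ⇑(ExtAdjunction.extAdjunctionAddEquiv (coindResAdj U hU) N C r) =
      (fun φ => φ.comp (shapiroCanonical U hU (triv (k := k) (Γ := Γ) k) N s).toAddMonoidHom) ∘
        ⇑(ExtDuality.adjointMap invΓ ((coindD k U hU).obj N) h) :=
    funext fun x => adjointMap_shapiro U hU C invΓ N h x
  constructor
  · intro hΓ
    have h2 : Function.Surjective (⇑(ExtDuality.adjointMap (invΓ.comp (extCores U hU C 2)) N h) ∘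
        ⇑(ExtAdjunction.extAdjunctionAddEquiv (coindResAdj U hU) N C r)) := by
      rw [key]
      exact (comp_addEquiv_surjective _).comp hΓ
    exact Function.Surjective.of_comp h2
  · intro hU'
    have h2 : Function.Surjective ((fun φ => φ.comp (shapiroCanonical U hU (triv (k := k) (Γ := Γ) k) N
        s).toAddMonoidHom) ∘ ⇑(ExtDuality.adjointMap invΓ ((coindD k U hU).obj N) h)) := by
      rw [← key]
      exact hU'.comp (AddEquiv.surjective _)
    exact h2.of_comp_left (comp_addEquiv_injective _)

/-- **Shapiro column of (1.9.1)**: `α^r(U, N)` is bijective iff `α^r(Γ, Coind N)` is.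
[cite: MilneADT2006, I Theorem 1.8 (proof, (1.9.1))][cite: Harari2020, Proposition 16.18] -/
theorem adjointBijective_coind_iff (N : DiscreteRepCat k U) {r s : ℕ} (h : s + r = 2) :
    ExtDuality.AdjointBijective invΓ ((coindD k U hU).obj N) h ↔
      ExtDuality.AdjointBijective (invΓ.comp (extCores U hU C 2)) N h :=
  and_congr (adjointInjective_coind_iff U hU C invΓ N h) (adjointSurjective_coind_iff U hU C invΓ N h)

end Pairing

end DiscreteRep

end Literature.Algebra.Homology
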